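import Mathlib.Analysis.PSeries
import Mathlib.Analysis.Real.Pi.Bounds
import HarnessLib

/-!
# K1loc, line `Spectral` / thin start — helper: THE NUMERIC SERIES OF THE PHASE-ONE START AT `γ = 8` (S-D start)

Helper file of the prover lane on the crux `K1LocalisedCascade` (stmt-AnomalousDissipation-19491), route `SawtoothPulseCascade`
(S-B/S-C assembly seat; START of the amplitude ledger).  Pure real arithmetic, no Fourier analysis: the fibre series of
`…PhaseOneStart.tsum_weight_sq_norm_phaseOne_le_exact` at `γ = 8`, aperture `2`, strip `K₁ ≤ 4`, is dominated termwise by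
`β(m) = w(m)·min(1, (√L(m) + mε)²)`, `m = |n|`, with the weight table `w(m) = [m odd](1/(π(8+m)) + 1/(π|8−m|))² + [m = 8]/4`
(`…ExactChirpSelf`), the low-pass level `L(m) = (4m+1)/(9π²m²)` (`…ExactChirp`, even frequency `8m`, cut `4m`) and the rounding
slope `ε = 8(2e^{1/2}−1)δ₀`.  This file proves **`Σ_{m∈T} β(m) ≤ 1/220` for every finite `T ⊆ ℕ` when `0 ≤ ε ≤ 2⁻²⁵`**
(`sum_phaseOne_series_le`): head `m ≤ 16` term by term (`1/π⁴ ≤ 0.010267`, `1/π² ≤ 0.101322`), middle `17 ≤ m ≤ 8192` by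
`w(m)L(m) ≤ 3.17/(π⁴m³)` and `Σ 1/m² ≤ 1/16` (`sum_Ioc_inv_sq_le_sub`), tail `m > 8192` by `w ≤ 6.6/(π²m²)` and `Σ_{m>8192} 1/m² ≤ 1/8192`;
and the folding `Σ_{n∈S} β(|n|) ≤ 1/110` over `S ⊆ ℤ` (`sum_int_phaseOne_series_le`).  Value of record: the series is `≈ 0.0040 < 1/220`.
No definitions; nothing about the crux. [folklore] [problem: turb]
-/

-- `Summit.<Summit>.<Problem>`: single-conjunct summit, the duplicate namespace segment is deliberate.
set_option linter.dupNamespace false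

noncomputable section

namespace Summit.AnomalousDissipation.AnomalousDissipation.Theorems.SawtoothPulseCascade.K1Start

open Finset Real

/-! ## §1 Numeric constants -/

/-- `1/π² ≤ 0.101322` (from `π > 3.141592`). [folklore] -/
theorem inv_pi_sq_le : 1 / π ^ 2 ≤ 0.101322 := by
  have h := Real.pi_gt_d6
  rw [div_le_iff₀ (by positivity)]
  nlinarith

/-- `1/π⁴ ≤ 0.010267` (from `π > 3.141592`). [folklore] -/
theorem inv_pi_pow_four_le : 1 / π ^ 4 ≤ 0.010267 := by
  have h := Real.pi_gt_d6
  have h2 : (3.141592 : ℝ) ^ 2 < π ^ 2 := by nlinarith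
  have h4 : (3.141592 : ℝ) ^ 2 * (3.141592 : ℝ) ^ 2 < π ^ 2 * π ^ 2 := by nlinarith
  rw [div_le_iff₀ (by positivity)]
  nlinarith

/-! ## §2 The termwise majorants -/

/-- AM–GM form of the rounding perturbation: `(√L + x)² ≤ (17/16)L + 17x²` for `L ≥ 0`. [folklore] -/
theorem sq_sqrt_add_le {L x : ℝ} (hL : 0 ≤ L) : (Real.sqrt L + x) ^ 2 ≤ 17 / 16 * L + 17 * x ^ 2 := by
  have hs := Real.sq_sqrt hL
  nlinarith [sq_nonneg (Real.sqrt L / 4 - 4 * x), Real.sqrt_nonneg L]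

/-- The odd-fibre weight is at most `4/9 ≤ 1`: `(1/(π(8+m)) + 1/(π|8−m|))² ≤ 1` for `m ≠ 8`. [folklore] -/
theorem odd_weight_le_one {m : ℕ} (hm : m ≠ 8) :
    (1 / (π * ((8 : ℝ) + m)) + 1 / (π * |(8 : ℝ) - m|)) ^ 2 ≤ 1 := by
  have hπ : 3 < π := Real.pi_gt_three
  have hm0 : (0 : ℝ) ≤ m := Nat.cast_nonneg m
  have h8 : (1 : ℝ) ≤ |(8 : ℝ) - m| := by
    rcases Nat.lt_or_gt_of_ne hm with h | h
    · have : (m : ℝ) ≤ 7 := by exact_mod_cast Nat.lt_succ_iff.mp h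
      rw [abs_of_pos (by linarith)]; linarith
    · have : (9 : ℝ) ≤ m := by exact_mod_cast h
      rw [abs_of_neg (by linarith)]; linarith
  have h1 : 1 / (π * ((8 : ℝ) + m)) ≤ 1 / 3 := by
    rw [div_le_div_iff₀ (by positivity) (by norm_num)]; nlinarith
  have h2 : 1 / (π * |(8 : ℝ) - m|) ≤ 1 / 3 := by
    rw [div_le_div_iff₀ (by positivity) (by norm_num)]; nlinarith
  have h0 : 0 ≤ 1 / (π * ((8 : ℝ) + m)) + 1 / (π * |(8 : ℝ) - m|) := by positivity
  nlinarith

/-- **Head majorant (odd fibres)**: for odd `m`,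
`w(m)·min(1,(√L(m) + mε)²) ≤ (17/16)·R(m)·(1/π⁴) + 17m²ε²` with the rational `R(m) = (1/(8+m) + 1/|8−m|)²(4m+1)/(9m²)`. [folklore] -/
theorem term_le_of_odd {m : ℕ} (hm : Odd m) {ε : ℝ} :
    (1 / (π * ((8 : ℝ) + m)) + 1 / (π * |(8 : ℝ) - m|)) ^ 2 *
        min 1 ((Real.sqrt ((4 * (m : ℝ) + 1) / (9 * π ^ 2 * (m : ℝ) ^ 2)) + m * ε) ^ 2) ≤
      17 / 16 * ((1 / ((8 : ℝ) + m) + 1 / |(8 : ℝ) - m|) ^ 2 * ((4 * (m : ℝ) + 1) / (9 * (m : ℝ) ^ 2))) * (1 / π ^ 4) +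
        17 * (m : ℝ) ^ 2 * ε ^ 2 := by
  have hπ : 0 < π := Real.pi_pos
  have hm8 : m ≠ 8 := by rintro rfl; exact (by decide : ¬ Odd 8) hm
  have hm1 : (1 : ℝ) ≤ m := by
    obtain ⟨k, rfl⟩ := hm; push_cast; linarith [(Nat.cast_nonneg k : (0:ℝ) ≤ k)]
  have hw0 : 0 ≤ (1 / (π * ((8 : ℝ) + m)) + 1 / (π * |(8 : ℝ) - m|)) ^ 2 := sq_nonneg _
  have hw1 := odd_weight_le_one hm8 (m := m)
  have hL0 : 0 ≤ (4 * (m : ℝ) + 1) / (9 * π ^ 2 * (m : ℝ) ^ 2) := by positivity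
  -- drop the `min`, then AM–GM
  have hmin : min 1 ((Real.sqrt ((4 * (m : ℝ) + 1) / (9 * π ^ 2 * (m : ℝ) ^ 2)) + m * ε) ^ 2) ≤
      17 / 16 * ((4 * (m : ℝ) + 1) / (9 * π ^ 2 * (m : ℝ) ^ 2)) + 17 * (m * ε) ^ 2 :=
    (min_le_right _ _).trans (sq_sqrt_add_le hL0)
  -- the exact identity `w·L = R/π⁴`
  have hid : (1 / (π * ((8 : ℝ) + m)) + 1 / (π * |(8 : ℝ) - m|)) ^ 2 * ((4 * (m : ℝ) + 1) / (9 * π ^ 2 * (m : ℝ) ^ 2)) =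
      (1 / ((8 : ℝ) + m) + 1 / |(8 : ℝ) - m|) ^ 2 * ((4 * (m : ℝ) + 1) / (9 * (m : ℝ) ^ 2)) * (1 / π ^ 4) := by
    have ha : (8 : ℝ) + m ≠ 0 := by positivity
    have hb : |(8 : ℝ) - m| ≠ 0 := by
      rw [abs_ne_zero, sub_ne_zero]; exact_mod_cast (Ne.symm hm8)
    have hm0 : (m : ℝ) ≠ 0 := by positivity
    field_simp
  calc (1 / (π * ((8 : ℝ) + m)) + 1 / (π * |(8 : ℝ) - m|)) ^ 2 *
        min 1 ((Real.sqrt ((4 * (m : ℝ) + 1) / (9 * π ^ 2 * (m : ℝ) ^ 2)) + m * ε) ^ 2)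
      ≤ (1 / (π * ((8 : ℝ) + m)) + 1 / (π * |(8 : ℝ) - m|)) ^ 2 *
          (17 / 16 * ((4 * (m : ℝ) + 1) / (9 * π ^ 2 * (m : ℝ) ^ 2)) + 17 * (m * ε) ^ 2) :=
        mul_le_mul_of_nonneg_left hmin hw0
    _ = 17 / 16 * ((1 / (π * ((8 : ℝ) + m)) + 1 / (π * |(8 : ℝ) - m|)) ^ 2 * ((4 * (m : ℝ) + 1) / (9 * π ^ 2 * (m : ℝ) ^ 2))) +
          (1 / (π * ((8 : ℝ) + m)) + 1 / (π * |(8 : ℝ) - m|)) ^ 2 * (17 * (m * ε) ^ 2) := by ring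
    _ ≤ 17 / 16 * ((1 / ((8 : ℝ) + m) + 1 / |(8 : ℝ) - m|) ^ 2 * ((4 * (m : ℝ) + 1) / (9 * (m : ℝ) ^ 2)) * (1 / π ^ 4)) +
          1 * (17 * (m * ε) ^ 2) := by
        rw [hid]; gcongr
    _ = _ := by ring

/-- **Middle/tail weight bound**: for `m ≥ 17`, `(1/(π(8+m)) + 1/(π|8−m|))² ≤ (578/225)²·(1/π²)/m²`
(`1/(8+m) + 1/(m−8) = 2m/(m²−64)` and `m² − 64 ≥ (225/289)m²`). [folklore] -/
theorem odd_weight_le_of_ge {m : ℕ} (hm : 17 ≤ m) :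
    (1 / (π * ((8 : ℝ) + m)) + 1 / (π * |(8 : ℝ) - m|)) ^ 2 ≤ (578 / 225) ^ 2 * (1 / π ^ 2) / (m : ℝ) ^ 2 := by
  have hπ : 0 < π := Real.pi_pos
  have hm' : (17 : ℝ) ≤ m := by exact_mod_cast hm
  have hm0 : (0 : ℝ) < m := by linarith
  rw [abs_of_neg (by linarith)]
  have h64 : (m : ℝ) ^ 2 - 64 ≠ 0 := by nlinarith
  have h8 : (8 : ℝ) - m ≠ 0 := by linarith
  have h8' : -((8 : ℝ) - m) ≠ 0 := by linarith
  have hsum : 1 / (π * ((8 : ℝ) + m)) + 1 / (π * -((8 : ℝ) - m)) = (1 / π) * (2 * m / ((m : ℝ) ^ 2 - 64)) := by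
    rw [div_add_div _ _ (by positivity) (mul_ne_zero hπ.ne' h8'), div_mul_div_comm, one_mul, div_eq_div_iff
      (mul_ne_zero (by positivity) (mul_ne_zero hπ.ne' h8')) (mul_ne_zero hπ.ne' h64)]
    ring
  rw [hsum, mul_pow]
  have hkey : 2 * (m : ℝ) / ((m : ℝ) ^ 2 - 64) ≤ 578 / 225 / m := by
    rw [div_le_div_iff₀ (by nlinarith) hm0]
    nlinarith
  have hk0 : 0 ≤ 2 * (m : ℝ) / ((m : ℝ) ^ 2 - 64) := div_nonneg (by linarith) (by nlinarith)
  calc (1 / π) ^ 2 * (2 * (m : ℝ) / ((m : ℝ) ^ 2 - 64)) ^ 2 ≤ (1 / π) ^ 2 * (578 / 225 / m) ^ 2 := by gcongr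
    _ = (578 / 225) ^ 2 * (1 / π ^ 2) / (m : ℝ) ^ 2 := by field_simp

/-- **Middle majorant**: for `m ≥ 17` and the fibre weight `w(m) = [odd]·(…)² + [m=8]/4` (so `w(m) ≤ (578/225)²/(π²m²)`),
`w(m)·min(1,(√L(m) + mε)²) ≤ (578/225)²·(69/144)·(1/π⁴)/m³ + 17(578/225)²·(1/π²)·ε²`. [folklore] -/
theorem term_le_of_ge {m : ℕ} (hm : 17 ≤ m) {ε : ℝ} :
    (if Odd m then (1 / (π * ((8 : ℝ) + m)) + 1 / (π * |(8 : ℝ) - m|)) ^ 2 else if m = 8 then (1 / 4 : ℝ) else 0) *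
        min 1 ((Real.sqrt ((4 * (m : ℝ) + 1) / (9 * π ^ 2 * (m : ℝ) ^ 2)) + m * ε) ^ 2) ≤
      (578 / 225) ^ 2 * (69 / 144) * (1 / π ^ 4) / (m : ℝ) ^ 3 + 17 * (578 / 225) ^ 2 * (1 / π ^ 2) * ε ^ 2 := by
  have hπ : 0 < π := Real.pi_pos
  have hm' : (17 : ℝ) ≤ m := by exact_mod_cast hm
  have hm0 : (0 : ℝ) < m := by linarith
  have hw : (if Odd m then (1 / (π * ((8 : ℝ) + m)) + 1 / (π * |(8 : ℝ) - m|)) ^ 2 else if m = 8 then (1 / 4 : ℝ) else 0) ≤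
      (578 / 225) ^ 2 * (1 / π ^ 2) / (m : ℝ) ^ 2 := by
    split_ifs with ho h8
    · exact odd_weight_le_of_ge hm
    · exfalso; omega
    · positivity
  have hw0 : 0 ≤ (if Odd m then (1 / (π * ((8 : ℝ) + m)) + 1 / (π * |(8 : ℝ) - m|)) ^ 2 else if m = 8 then (1 / 4 : ℝ) else 0) := by
    split_ifs <;> positivity
  have hL0 : 0 ≤ (4 * (m : ℝ) + 1) / (9 * π ^ 2 * (m : ℝ) ^ 2) := by positivity
  have hmin0 : 0 ≤ min 1 ((Real.sqrt ((4 * (m : ℝ) + 1) / (9 * π ^ 2 * (m : ℝ) ^ 2)) + m * ε) ^ 2) :=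
    le_min zero_le_one (sq_nonneg _)
  have hmin : min 1 ((Real.sqrt ((4 * (m : ℝ) + 1) / (9 * π ^ 2 * (m : ℝ) ^ 2)) + m * ε) ^ 2) ≤
      17 / 16 * ((4 * (m : ℝ) + 1) / (9 * π ^ 2 * (m : ℝ) ^ 2)) + 17 * (m * ε) ^ 2 :=
    (min_le_right _ _).trans (sq_sqrt_add_le hL0)
  -- `(4m+1)/m² ≤ (69/17)/m` for `m ≥ 17`
  have hL : (4 * (m : ℝ) + 1) / (9 * π ^ 2 * (m : ℝ) ^ 2) ≤ (69 / 17) / (9 * π ^ 2 * m) := by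
    have hL' : (4 * (m : ℝ) + 1) * m ≤ 69 / 17 * (m : ℝ) ^ 2 := by nlinarith
    rw [div_le_div_iff₀ (by positivity) (by positivity)]
    have h9 : (0 : ℝ) ≤ 9 * π ^ 2 := by positivity
    nlinarith [mul_le_mul_of_nonneg_left hL' h9]
  calc _ ≤ ((578 / 225) ^ 2 * (1 / π ^ 2) / (m : ℝ) ^ 2) *
          (17 / 16 * ((4 * (m : ℝ) + 1) / (9 * π ^ 2 * (m : ℝ) ^ 2)) + 17 * (m * ε) ^ 2) :=
        mul_le_mul hw hmin hmin0 (by positivity)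
    _ ≤ ((578 / 225) ^ 2 * (1 / π ^ 2) / (m : ℝ) ^ 2) * (17 / 16 * ((69 / 17) / (9 * π ^ 2 * m)) + 17 * (m * ε) ^ 2) := by
        gcongr
    _ = (578 / 225) ^ 2 * (69 / 144) * (1 / π ^ 4) / (m : ℝ) ^ 3 + 17 * (578 / 225) ^ 2 * (1 / π ^ 2) * ε ^ 2 := by
        field_simp
        ring

/-- **Tail majorant**: for `m ≥ 17`, `w(m)·min(1, ·) ≤ (578/225)²(1/π²)/m²`. [folklore] -/
theorem term_le_tail {m : ℕ} (hm : 17 ≤ m) {ε : ℝ} :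
    (if Odd m then (1 / (π * ((8 : ℝ) + m)) + 1 / (π * |(8 : ℝ) - m|)) ^ 2 else if m = 8 then (1 / 4 : ℝ) else 0) *
        min 1 ((Real.sqrt ((4 * (m : ℝ) + 1) / (9 * π ^ 2 * (m : ℝ) ^ 2)) + m * ε) ^ 2) ≤
      (578 / 225) ^ 2 * (1 / π ^ 2) / (m : ℝ) ^ 2 := by
  have hw : (if Odd m then (1 / (π * ((8 : ℝ) + m)) + 1 / (π * |(8 : ℝ) - m|)) ^ 2 else if m = 8 then (1 / 4 : ℝ) else 0) ≤
      (578 / 225) ^ 2 * (1 / π ^ 2) / (m : ℝ) ^ 2 := by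
    split_ifs with ho h8
    · exact odd_weight_le_of_ge hm
    · exfalso; omega
    · positivity
  have hmin0 : 0 ≤ min 1 ((Real.sqrt ((4 * (m : ℝ) + 1) / (9 * π ^ 2 * (m : ℝ) ^ 2)) + m * ε) ^ 2) :=
    le_min zero_le_one (sq_nonneg _)
  calc _ ≤ ((578 / 225) ^ 2 * (1 / π ^ 2) / (m : ℝ) ^ 2) * 1 :=
        mul_le_mul hw (min_le_left _ _) hmin0 (by positivity)
    _ = _ := mul_one _

/-! ## §3 The three partial sums -/

/-- The generic term of the series (weight × capped low-pass level) is non-negative. [folklore] -/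
theorem term_nonneg (m : ℕ) (ε : ℝ) :
    0 ≤ (if Odd m then (1 / (π * ((8 : ℝ) + m)) + 1 / (π * |(8 : ℝ) - m|)) ^ 2 else if m = 8 then (1 / 4 : ℝ) else 0) *
        min 1 ((Real.sqrt ((4 * (m : ℝ) + 1) / (9 * π ^ 2 * (m : ℝ) ^ 2)) + m * ε) ^ 2) :=
  mul_nonneg (by split_ifs <;> positivity) (le_min zero_le_one (sq_nonneg _))

/-- **Head** (`m ≤ 16`): the terms add up to at most `0.0038 + 12648ε²` (eight odd fibres and the main lobe `m = 8`).
[folklore] -/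
theorem sum_head_le {ε : ℝ} (T : Finset ℕ) :
    ∑ m ∈ T.filter (· ≤ 16),
        (if Odd m then (1 / (π * ((8 : ℝ) + m)) + 1 / (π * |(8 : ℝ) - m|)) ^ 2 else if m = 8 then (1 / 4 : ℝ) else 0) *
          min 1 ((Real.sqrt ((4 * (m : ℝ) + 1) / (9 * π ^ 2 * (m : ℝ) ^ 2)) + m * ε) ^ 2) ≤
      0.0038 + 12648 * ε ^ 2 := by
  classical
  -- the explicit majorant `g`
  set g : ℕ → ℝ := fun m => if Odd m then
      17 / 16 * ((1 / ((8 : ℝ) + m) + 1 / |(8 : ℝ) - m|) ^ 2 * ((4 * (m : ℝ) + 1) / (9 * (m : ℝ) ^ 2))) * (1 / π ^ 4) +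
        17 * (m : ℝ) ^ 2 * ε ^ 2
    else if m = 8 then 17 / 16 * (11 / 768) * (1 / π ^ 2) + 272 * ε ^ 2 else 0 with hg
  have hle : ∀ m : ℕ, (if Odd m then (1 / (π * ((8 : ℝ) + m)) + 1 / (π * |(8 : ℝ) - m|)) ^ 2 else if m = 8 then (1 / 4 : ℝ) else 0) *
      min 1 ((Real.sqrt ((4 * (m : ℝ) + 1) / (9 * π ^ 2 * (m : ℝ) ^ 2)) + m * ε) ^ 2) ≤ g m := by
    intro m
    simp only [hg]
    split_ifs with ho h8
    · exact term_le_of_odd ho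
    · subst h8
      have hL0 : 0 ≤ (4 * ((8:ℕ) : ℝ) + 1) / (9 * π ^ 2 * ((8:ℕ) : ℝ) ^ 2) := by positivity
      have hmin := (min_le_right (1:ℝ) _).trans (sq_sqrt_add_le (x := (8:ℕ) * ε) hL0)
      have hπ : 0 < π := Real.pi_pos
      calc (1 / 4 : ℝ) * min 1 ((Real.sqrt ((4 * ((8:ℕ) : ℝ) + 1) / (9 * π ^ 2 * ((8:ℕ) : ℝ) ^ 2)) + (8:ℕ) * ε) ^ 2)
          ≤ 1 / 4 * (17 / 16 * ((4 * ((8:ℕ) : ℝ) + 1) / (9 * π ^ 2 * ((8:ℕ) : ℝ) ^ 2)) + 17 * ((8:ℕ) * ε) ^ 2) :=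
            mul_le_mul_of_nonneg_left hmin (by norm_num)
        _ = 17 / 16 * (11 / 768) * (1 / π ^ 2) + 272 * ε ^ 2 := by push_cast; field_simp; ring
    · have h0 : min 1 ((Real.sqrt ((4 * (m : ℝ) + 1) / (9 * π ^ 2 * (m : ℝ) ^ 2)) + m * ε) ^ 2) ≤ 1 := min_le_left _ _
      linarith [le_min zero_le_one (sq_nonneg (Real.sqrt ((4 * (m : ℝ) + 1) / (9 * π ^ 2 * (m : ℝ) ^ 2)) + m * ε))]
  have hg0 : ∀ m, 0 ≤ g m := fun m => by
    simp only [hg]; split_ifs <;> positivity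
  have hsub : T.filter (· ≤ 16) ⊆ Finset.range 17 := by
    intro m hm
    rw [Finset.mem_filter] at hm
    exact Finset.mem_range.2 (by omega)
  calc _ ≤ ∑ m ∈ T.filter (· ≤ 16), g m := Finset.sum_le_sum fun m _ => hle m
    _ ≤ ∑ m ∈ Finset.range 17, g m := Finset.sum_le_sum_of_subset_of_nonneg hsub fun m _ _ => hg0 m
    _ ≤ 0.0038 + 12648 * ε ^ 2 := by
        have hA : (π ^ 4)⁻¹ ≤ 0.010267 := by rw [← one_div]; exact inv_pi_pow_four_le
        have hB : (π ^ 2)⁻¹ ≤ 0.101322 := by rw [← one_div]; exact inv_pi_sq_le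
        have hA0 : 0 ≤ (π ^ 4)⁻¹ := by positivity
        have hB0 : 0 ≤ (π ^ 2)⁻¹ := by positivity
        have hε0 : 0 ≤ ε ^ 2 := sq_nonneg ε
        simp only [Finset.sum_range_succ, Finset.sum_range_zero, hg]
        norm_num [Nat.odd_iff]
        linarith

/-- **Middle** (`17 ≤ m ≤ 8192`): at most `0.18601·(1/π⁴)·(1/16) + 8192·17·(578/225)²·(1/π²)·ε²`. [folklore] -/
theorem sum_middle_le {ε : ℝ} (T : Finset ℕ) :
    ∑ m ∈ T.filter (fun m => 17 ≤ m ∧ m ≤ 8192),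
        (if Odd m then (1 / (π * ((8 : ℝ) + m)) + 1 / (π * |(8 : ℝ) - m|)) ^ 2 else if m = 8 then (1 / 4 : ℝ) else 0) *
          min 1 ((Real.sqrt ((4 * (m : ℝ) + 1) / (9 * π ^ 2 * (m : ℝ) ^ 2)) + m * ε) ^ 2) ≤
      (578 / 225) ^ 2 * (69 / 144) / 17 * (1 / π ^ 4) * (1 / 16) + 8192 * (17 * (578 / 225) ^ 2 * (1 / π ^ 2) * ε ^ 2) := by
  classical
  set T₂ := T.filter (fun m => 17 ≤ m ∧ m ≤ 8192) with hT₂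
  have hmem : ∀ m ∈ T₂, 17 ≤ m ∧ m ≤ 8192 := fun m hm => (Finset.mem_filter.1 hm).2
  -- termwise
  have h1 : ∑ m ∈ T₂, (if Odd m then (1 / (π * ((8 : ℝ) + m)) + 1 / (π * |(8 : ℝ) - m|)) ^ 2 else if m = 8 then (1 / 4 : ℝ) else 0) *
        min 1 ((Real.sqrt ((4 * (m : ℝ) + 1) / (9 * π ^ 2 * (m : ℝ) ^ 2)) + m * ε) ^ 2) ≤
      ∑ m ∈ T₂, ((578 / 225) ^ 2 * (69 / 144) * (1 / π ^ 4) / (m : ℝ) ^ 3 + 17 * (578 / 225) ^ 2 * (1 / π ^ 2) * ε ^ 2) :=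
    Finset.sum_le_sum fun m hm => term_le_of_ge (hmem m hm).1
  -- `1/m³ ≤ (1/17)·(1/m²)` and the inverse-square sum over `(16, 8192]`
  have h2 : ∑ m ∈ T₂, (578 / 225 : ℝ) ^ 2 * (69 / 144) * (1 / π ^ 4) / (m : ℝ) ^ 3 ≤
      (578 / 225) ^ 2 * (69 / 144) / 17 * (1 / π ^ 4) * (1 / 16) := by
    have hterm : ∀ m ∈ T₂, (578 / 225 : ℝ) ^ 2 * (69 / 144) * (1 / π ^ 4) / (m : ℝ) ^ 3 ≤
        (578 / 225) ^ 2 * (69 / 144) / 17 * (1 / π ^ 4) * ((m : ℝ) ^ 2)⁻¹ := by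
      intro m hm
      have hm17 : (17 : ℝ) ≤ m := by exact_mod_cast (hmem m hm).1
      have hm0 : (0 : ℝ) < m := by linarith
      rw [div_eq_mul_inv]
      have : ((m : ℝ) ^ 3)⁻¹ ≤ 1 / 17 * ((m : ℝ) ^ 2)⁻¹ := by
        rw [show (m : ℝ) ^ 3 = m * (m : ℝ) ^ 2 by ring, mul_inv, one_div]
        exact mul_le_mul_of_nonneg_right (inv_anti₀ (by norm_num) hm17) (by positivity)
      calc (578 / 225 : ℝ) ^ 2 * (69 / 144) * (1 / π ^ 4) * ((m : ℝ) ^ 3)⁻¹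
          ≤ (578 / 225 : ℝ) ^ 2 * (69 / 144) * (1 / π ^ 4) * (1 / 17 * ((m : ℝ) ^ 2)⁻¹) := by gcongr
        _ = _ := by ring
    refine (Finset.sum_le_sum hterm).trans ?_
    rw [← Finset.mul_sum]
    refine mul_le_mul_of_nonneg_left ?_ (by positivity)
    have hsub : T₂ ⊆ Finset.Ioc 16 8192 := by
      intro m hm; rw [Finset.mem_Ioc]; have := hmem m hm; omega
    calc ∑ m ∈ T₂, ((m : ℝ) ^ 2)⁻¹ ≤ ∑ m ∈ Finset.Ioc (16 : ℕ) 8192, ((m : ℝ) ^ 2)⁻¹ :=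
          Finset.sum_le_sum_of_subset_of_nonneg hsub fun m _ _ => by positivity
      _ ≤ ((16 : ℕ) : ℝ)⁻¹ - ((8192 : ℕ) : ℝ)⁻¹ :=
          sum_Ioc_inv_sq_le_sub (α := ℝ) (k := 16) (n := 8192) (by norm_num) (by norm_num)
      _ ≤ 1 / 16 := by norm_num
  have h3 : ∑ m ∈ T₂, (17 : ℝ) * (578 / 225) ^ 2 * (1 / π ^ 2) * ε ^ 2 ≤ 8192 * (17 * (578 / 225) ^ 2 * (1 / π ^ 2) * ε ^ 2) := by
    rw [Finset.sum_const, nsmul_eq_mul]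
    refine mul_le_mul_of_nonneg_right ?_ (by positivity)
    have hcard : T₂.card ≤ (Finset.Ioc 16 8192).card :=
      Finset.card_le_card fun m hm => by rw [Finset.mem_Ioc]; have := hmem m hm; omega
    rw [Nat.card_Ioc] at hcard
    exact_mod_cast hcard.trans (by norm_num)
  rw [Finset.sum_add_distrib] at h1
  linarith

/-- **Tail** (`m > 8192`): at most `(578/225)²·(1/π²)/8192`. [folklore] -/
theorem sum_tail_le {ε : ℝ} (T : Finset ℕ) :
    ∑ m ∈ T.filter (fun m => 8192 < m),
        (if Odd m then (1 / (π * ((8 : ℝ) + m)) + 1 / (π * |(8 : ℝ) - m|)) ^ 2 else if m = 8 then (1 / 4 : ℝ) else 0) *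
          min 1 ((Real.sqrt ((4 * (m : ℝ) + 1) / (9 * π ^ 2 * (m : ℝ) ^ 2)) + m * ε) ^ 2) ≤
      (578 / 225) ^ 2 * (1 / π ^ 2) * (1 / 8192) := by
  classical
  set T₃ := T.filter (fun m => 8192 < m) with hT₃
  have hmem : ∀ m ∈ T₃, 8192 < m := fun m hm => (Finset.mem_filter.1 hm).2
  have h1 : ∑ m ∈ T₃, (if Odd m then (1 / (π * ((8 : ℝ) + m)) + 1 / (π * |(8 : ℝ) - m|)) ^ 2 else if m = 8 then (1 / 4 : ℝ) else 0) *
        min 1 ((Real.sqrt ((4 * (m : ℝ) + 1) / (9 * π ^ 2 * (m : ℝ) ^ 2)) + m * ε) ^ 2) ≤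
      ∑ m ∈ T₃, (578 / 225 : ℝ) ^ 2 * (1 / π ^ 2) / (m : ℝ) ^ 2 :=
    Finset.sum_le_sum fun m hm => term_le_tail (by have := hmem m hm; omega)
  refine h1.trans ?_
  simp_rw [div_eq_mul_inv]
  rw [← Finset.mul_sum]
  refine mul_le_mul_of_nonneg_left ?_ (by positivity)
  -- the inverse squares over `T₃ ⊆ (8192, M]`
  set M := T₃.sup id ⊔ 8192 with hM
  have hsub : T₃ ⊆ Finset.Ioc 8192 M := by
    intro m hm
    rw [Finset.mem_Ioc]
    exact ⟨hmem m hm, le_sup_of_le_left (Finset.le_sup (f := id) hm)⟩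
  calc ∑ m ∈ T₃, ((m : ℝ) ^ 2)⁻¹ ≤ ∑ m ∈ Finset.Ioc (8192 : ℕ) M, ((m : ℝ) ^ 2)⁻¹ :=
        Finset.sum_le_sum_of_subset_of_nonneg hsub fun m _ _ => by positivity
    _ ≤ ((8192 : ℕ) : ℝ)⁻¹ - (M : ℝ)⁻¹ :=
        sum_Ioc_inv_sq_le_sub (α := ℝ) (k := 8192) (n := M) (by norm_num) le_sup_right
    _ ≤ 1 / 8192 := by
        have : (0 : ℝ) ≤ (M : ℝ)⁻¹ := by positivity
        have h8 : ((8192 : ℕ) : ℝ)⁻¹ = 1 / 8192 := by norm_num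
        linarith

/-! ## §4 The series bound and its folding over `ℤ` -/

/-- **The phase-one series over `ℕ`**: for `0 ≤ ε ≤ 2⁻²⁵` and every finite `T ⊆ ℕ`, `Σ_{m∈T} w(m)·min(1,(√L(m) + mε)²) ≤ 1/220`.
[folklore] -/
theorem sum_phaseOne_series_le {ε : ℝ} (hε0 : 0 ≤ ε) (hε : ε ≤ (2 : ℝ)⁻¹ ^ 25) (T : Finset ℕ) :
    ∑ m ∈ T, (if Odd m then (1 / (π * ((8 : ℝ) + m)) + 1 / (π * |(8 : ℝ) - m|)) ^ 2 else if m = 8 then (1 / 4 : ℝ) else 0) *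
        min 1 ((Real.sqrt ((4 * (m : ℝ) + 1) / (9 * π ^ 2 * (m : ℝ) ^ 2)) + m * ε) ^ 2) ≤ 1 / 220 := by
  classical
  set f : ℕ → ℝ := fun m => (if Odd m then (1 / (π * ((8 : ℝ) + m)) + 1 / (π * |(8 : ℝ) - m|)) ^ 2
      else if m = 8 then (1 / 4 : ℝ) else 0) *
    min 1 ((Real.sqrt ((4 * (m : ℝ) + 1) / (9 * π ^ 2 * (m : ℝ) ^ 2)) + m * ε) ^ 2) with hf
  -- split the index set
  have hsplit : ∑ m ∈ T, f m = ∑ m ∈ T.filter (· ≤ 16), f m +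
      (∑ m ∈ T.filter (fun m => 17 ≤ m ∧ m ≤ 8192), f m + ∑ m ∈ T.filter (fun m => 8192 < m), f m) := by
    rw [← Finset.sum_filter_add_sum_filter_not T (· ≤ 16)]
    congr 1
    rw [← Finset.sum_filter_add_sum_filter_not (T.filter fun m => ¬ m ≤ 16) (· ≤ 8192), Finset.filter_filter,
      Finset.filter_filter]
    congr 1
    · exact Finset.sum_congr (Finset.filter_congr fun m _ => by omega) fun _ _ => rfl
    · exact Finset.sum_congr (Finset.filter_congr fun m _ => by omega) fun _ _ => rfl
  have hH := sum_head_le (ε := ε) T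
  have hMid := sum_middle_le (ε := ε) T
  have hTail := sum_tail_le (ε := ε) T
  have hA := inv_pi_pow_four_le
  have hB := inv_pi_sq_le
  have hε2 : ε ^ 2 ≤ ((2 : ℝ)⁻¹ ^ 25) ^ 2 := pow_le_pow_left₀ hε0 hε 2
  change ∑ m ∈ T, f m ≤ 1 / 220
  rw [hsplit]
  simp only [hf] at hH hMid hTail ⊢
  nlinarith [hH, hMid, hTail, sq_nonneg ε]

/-- **Folding over `ℤ`**: if `t : ℤ → ℝ` is dominated by the series term at `m = |n|` (`t n ≤ f(n.natAbs)`), then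
`Σ_{n∈S} t(n) ≤ 1/110` for every finite `S ⊆ ℤ` (each fibre `{m, −m}` of `natAbs` has at most two points). [folklore] -/
theorem sum_int_phaseOne_series_le {ε : ℝ} (hε0 : 0 ≤ ε) (hε : ε ≤ (2 : ℝ)⁻¹ ^ 25) {t : ℤ → ℝ}
    (ht : ∀ n : ℤ, t n ≤ (if Odd n.natAbs then
        (1 / (π * ((8 : ℝ) + n.natAbs)) + 1 / (π * |(8 : ℝ) - n.natAbs|)) ^ 2 else if n.natAbs = 8 then (1 / 4 : ℝ) else 0) *
      min 1 ((Real.sqrt ((4 * (n.natAbs : ℝ) + 1) / (9 * π ^ 2 * (n.natAbs : ℝ) ^ 2)) + n.natAbs * ε) ^ 2))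
    (S : Finset ℤ) : ∑ n ∈ S, t n ≤ 1 / 110 := by
  classical
  set f : ℕ → ℝ := fun m => (if Odd m then (1 / (π * ((8 : ℝ) + m)) + 1 / (π * |(8 : ℝ) - m|)) ^ 2
      else if m = 8 then (1 / 4 : ℝ) else 0) *
    min 1 ((Real.sqrt ((4 * (m : ℝ) + 1) / (9 * π ^ 2 * (m : ℝ) ^ 2)) + m * ε) ^ 2) with hf
  have hf0 : ∀ m, 0 ≤ f m := fun m => term_nonneg m ε
  have h1 : ∑ n ∈ S, t n ≤ ∑ n ∈ S, f n.natAbs := Finset.sum_le_sum fun n _ => ht n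
  -- regroup along the fibres of `natAbs`
  set T := S.image Int.natAbs with hT
  have h2 : ∑ n ∈ S, f n.natAbs = ∑ m ∈ T, ∑ n ∈ S.filter (fun n => n.natAbs = m), f n.natAbs :=
    (Finset.sum_fiberwise_of_maps_to (fun n hn => Finset.mem_image_of_mem _ hn) _).symm
  have h3 : ∀ m ∈ T, ∑ n ∈ S.filter (fun n => n.natAbs = m), f n.natAbs ≤ 2 * f m := by
    intro m _
    have heq : ∑ n ∈ S.filter (fun n => n.natAbs = m), f n.natAbs = ∑ n ∈ S.filter (fun n => n.natAbs = m), f m :=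
      Finset.sum_congr rfl fun n hn => by rw [(Finset.mem_filter.1 hn).2]
    rw [heq, Finset.sum_const, nsmul_eq_mul]
    have hcard : (S.filter (fun n => n.natAbs = m)).card ≤ 2 := by
      have hsub : S.filter (fun n => n.natAbs = m) ⊆ {(m : ℤ), -(m : ℤ)} := by
        intro n hn
        rw [Finset.mem_insert, Finset.mem_singleton]
        have h := (Finset.mem_filter.1 hn).2
        rcases Int.natAbs_eq n with h' | h' <;> [left; right] <;> rw [h', h]
      exact (Finset.card_le_card hsub).trans (Finset.card_le_two)
    have : ((S.filter (fun n => n.natAbs = m)).card : ℝ) ≤ 2 := by exact_mod_cast hcard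
    exact mul_le_mul_of_nonneg_right this (hf0 m)
  have h4 := sum_phaseOne_series_le hε0 hε T
  calc ∑ n ∈ S, t n ≤ ∑ m ∈ T, ∑ n ∈ S.filter (fun n => n.natAbs = m), f n.natAbs := h1.trans (le_of_eq h2)
    _ ≤ ∑ m ∈ T, 2 * f m := Finset.sum_le_sum h3
    _ = 2 * ∑ m ∈ T, f m := by rw [Finset.mul_sum]
    _ ≤ 2 * (1 / 220) := by gcongr
    _ = 1 / 110 := by norm_num

end Summit.AnomalousDissipation.AnomalousDissipation.Theorems.SawtoothPulseCascade.K1Start
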